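import Mathlib
import Summits.Schanuel.Schanuel.Theorems.RigidCoreSparsityTwoDefs
import Literature.NumberTheory.Transcendental.BakerLogarithmsConclusion
import Literature.NumberTheory.Transcendental.BakerCoefficientForm

/-!
# Linear real-slope cusps are unitary (stub `stub_linearCuspUnitary`, lead c4)

Line `cusp-germ-schneider-sparsity` of the crux `RigidCore.SparsityTwo` (item stmt-Schanuel-0971), over the
definitions module `RigidCoreSparsityTwoDefs` (`CuspDatum`, `CuspDatum.IsLinearJet`).

`stub_linearCuspUnitary`: let `D` be a normalised cusp datum with a LINEAR `t`-jet
`Φ₁ t / t ^ N₀ = β (t ^ e)⁻¹ + G t` (`D.IsLinearJet β G`, `G` analytic at `0`), whose slope `β` is a REAL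
algebraic irrational number and whose constant `G 0` is algebraic.  Then the cusp is UNITARY,
`‖e^{ℓ₀ 0}‖ = ‖e^{ℓ₁ 0}‖ = 1`, and `Re G 0 = 0`.  This is the c4 normalisation that lets the open linear
atoms A1/A2 assume unitarity of the cusp values.

## Proof

* (analytic) By the linking identities `D.link` and the linear jet, on the punctured `σ`-disc
  `ℓ₁ (T σ) - β ℓ₀ (T σ) - G (T σ) = 2πi (β σ⁻ᵉ - A(σ⁻¹) - g σ)`.  On the positive real ray the bracket
  is REAL (`A` has real coefficients, `g` is real on the ray: `D.real`; `β` is real), so the real part of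
  the left side vanishes for all small `u > 0`; by continuity at `σ = 0` (`T 0 = 0`, all germs analytic)
  `Re ℓ₁ 0 = β · Re ℓ₀ 0 + Re G 0`.
* (arithmetic) Put `u₀ = Re ℓ₀ 0`, `u₁ = Re ℓ₁ 0`, `r = Re G 0`: `e^{uⱼ} = ‖e^{ℓⱼ 0}‖` is algebraic
  (`‖α‖² = α ᾱ`), `r = (G 0 + conj (G 0)) / 2` is algebraic, and `u₁ = β u₀ + r`.  Baker's theorem in
  coefficient form (`baker_coeff_eq_zero`, from the tree's PROVED `baker_holds`, Baker 1975 Thm 2.1)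
  leaves only `u₀ = u₁ = r = 0`: if `u₀ ≠ 0` and `u₀, u₁` are `ℚ`-independent, the relation
  `r + β u₀ - u₁ = 0` has the non-zero algebraic coefficient `-1`; if `u₁ = a u₀` with `a ∈ ℚ`, the
  relation `r + (β - a) u₀ = 0` forces `β = a`, contradicting irrationality; if `u₀ = 0 ≠ u₁` the relation
  `r - u₁ = 0` has coefficient `-1 ≠ 0`.  Hence `‖e^{ℓⱼ 0}‖ = e^{0} = 1` and `Re G 0 = 0`.

Sources: A. Baker, *Transcendental Number Theory* (CUP 1975), Ch. 2, Thm 2.1 — in the tree as the PROVED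
`Literature.NumberTheory.Transcendental.baker_holds` / `baker_coeff_eq_zero`; otherwise Mathlib only.
-/

noncomputable section

-- `Summit.Schanuel.Schanuel.…` is the mandated summit/sub-problem namespace (single-conjunct summit), hence:
set_option linter.dupNamespace false

namespace Summit.Schanuel.Schanuel.Cruxes.SparsityTwo.CuspGermSchneiderSparsity

open Filter Topology Complex Polynomial Literature.NumberTheory.Transcendental
open scoped Real

/-! ## Algebraicity bookkeeping -/

/-- The complex conjugate of an algebraic number is algebraic (`conj` is a `ℚ`-algebra map). -/
private theorem isAlgebraic_conj_of_isAlgebraic {z : ℂ} (hz : IsAlgebraic ℚ z) :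
    IsAlgebraic ℚ (starRingEnd ℂ z) := by
  simpa using hz.algHom (starRingEnd ℂ).toRatAlgHom

/-- The real part of an algebraic number is algebraic: `Re z = (z + conj z) / 2`. -/
private theorem isAlgebraic_ofReal_re {z : ℂ} (hz : IsAlgebraic ℚ z) :
    IsAlgebraic ℚ ((z.re : ℝ) : ℂ) := by
  rw [Complex.re_eq_add_conj, div_eq_mul_inv]
  exact (hz.add (isAlgebraic_conj_of_isAlgebraic hz)).mul (isAlgebraic_nat 2).inv

/-- The absolute value of an algebraic number is algebraic: `‖z‖ ^ 2 = z * conj z`. -/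
private theorem isAlgebraic_ofReal_norm {z : ℂ} (hz : IsAlgebraic ℚ z) :
    IsAlgebraic ℚ ((‖z‖ : ℝ) : ℂ) := by
  have hsq : ((‖z‖ : ℝ) : ℂ) ^ 2 = z * starRingEnd ℂ z := by
    rw [Complex.mul_conj, Complex.normSq_eq_norm_sq]
    push_cast
    ring
  exact IsAlgebraic.of_pow two_pos (hsq ▸ hz.mul (isAlgebraic_conj_of_isAlgebraic hz))

/-- If `e^w` is algebraic then so is `e^{Re w} = ‖e^w‖` (read in `ℂ`). -/
private theorem isAlgebraic_exp_ofReal_re {w : ℂ} (hw : IsAlgebraic ℚ (cexp w)) :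
    IsAlgebraic ℚ (cexp ((w.re : ℝ) : ℂ)) := by
  rw [← Complex.ofReal_exp, ← Complex.norm_exp]
  exact isAlgebraic_ofReal_norm hw

/-! ## The Baker step -/

/-- **One logarithm** (Baker Thm 2.1 with `n = 1`, i.e. Hermite–Lindemann–Gelfond in coefficient form):
if `e^l` is algebraic, `l ≠ 0`, and `c + b l = 0` with algebraic `b, c`, then `c = 0` and `b = 0`. -/
private theorem baker_one_log {l b c : ℂ} (hl : IsAlgebraic ℚ (cexp l)) (hl0 : l ≠ 0)
    (hb : IsAlgebraic ℚ b) (hc : IsAlgebraic ℚ c) (h : c + b * l = 0) : c = 0 ∧ b = 0 := by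
  have hli : LinearIndependent ℚ (fun _ : Fin 1 => l) := linearIndependent_unique_iff.2 hl0
  have hB := baker_coeff_eq_zero (fun _ : Fin 1 => l) (fun _ => hl) hli hc (β := fun _ => b)
    (fun _ => hb) (by simpa using h)
  exact ⟨hB.1, hB.2 0⟩

/-- **The affine Baker relation with irrational slope has only the trivial solution.**  If `e^{l₀}`,
`e^{l₁}` are algebraic, `β` is algebraic irrational, `c` is algebraic and `l₁ = β l₀ + c`, then
`l₀ = l₁ = c = 0` (Baker 1975 Thm 2.1, via `baker_coeff_eq_zero`). -/
private theorem baker_affine_trivial {l₀ l₁ β c : ℂ} (h₀ : IsAlgebraic ℚ (cexp l₀))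
    (h₁ : IsAlgebraic ℚ (cexp l₁)) (hβ : IsAlgebraic ℚ β) (hirr : ∀ r' : ℚ, (r' : ℂ) ≠ β)
    (hc : IsAlgebraic ℚ c) (hrel : l₁ = β * l₀ + c) : l₀ = 0 ∧ l₁ = 0 ∧ c = 0 := by
  by_cases hl₀ : l₀ = 0
  · subst hl₀
    have hl₁c : l₁ = c := by rw [hrel]; ring
    by_cases hl₁ : l₁ = 0
    · exact ⟨rfl, hl₁, hl₁c ▸ hl₁⟩
    · -- `c + (-1) l₁ = 0`: Baker with the single logarithm `l₁`
      exfalso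
      have h := baker_one_log h₁ hl₁ isAlgebraic_one.neg hc (b := -1) (by rw [hl₁c]; ring)
      norm_num at h
  · exfalso
    by_cases hli : LinearIndependent ℚ ![l₀, l₁]
    · -- `c + β l₀ + (-1) l₁ = 0`: Baker with the two independent logarithms
      have hB := baker_coeff_eq_zero ![l₀, l₁] (fun i => by fin_cases i <;> simpa) hli hc
        (β := ![β, -1]) (fun i => by fin_cases i <;> simp [hβ, isAlgebraic_one.neg])
        (by simp [Fin.sum_univ_two, hrel])
      simpa using hB.2 1
    · -- dependent: `l₁ = a l₀` with `a ∈ ℚ`, so `c + (β - a) l₀ = 0` forces `β = a`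
      rw [LinearIndependent.pair_iff' hl₀] at hli
      push Not at hli
      obtain ⟨a, ha⟩ := hli
      rw [Rat.smul_def] at ha
      have h := baker_one_log h₀ hl₀ (hβ.sub (isAlgebraic_rat ℚ a)) hc (b := β - a)
        (by linear_combination -ha - hrel)
      exact hirr a (by linear_combination -h.2)

/-! ## The stub -/

/-- **c4 normalisation: linear REAL-slope cusps are unitary** (registered stub `stub_linearCuspUnitary` of
line `cusp-germ-schneider-sparsity`, crux stmt-Schanuel-0971).  For a normalised cusp datum with linear
`t`-jet `x₂ = β x₁ + G t`, `β` real algebraic irrational and `G 0` algebraic, the cusp values are unitary,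
`‖e^{ℓ₀ 0}‖ = ‖e^{ℓ₁ 0}‖ = 1`, and `Re G 0 = 0`: the real part of the jet identity along the positive ray
gives `Re ℓ₁ 0 = β Re ℓ₀ 0 + Re G 0`, an affine relation between real logarithms of algebraic numbers with
irrational algebraic slope, which Baker's Thm 2.1 (`baker_holds`, PROVED in the tree) forces to be trivial. -/
theorem stub_linearCuspUnitary :
    ∀ (D : CuspDatum) (G : ℂ → ℂ) (β : ℂ), AnalyticAt ℂ G 0 → D.IsLinearJet β G →
      IsAlgebraic ℚ β → (∀ r' : ℚ, (r' : ℂ) ≠ β) → IsAlgebraic ℚ (G 0) → β.im = 0 →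
      ‖Complex.exp (D.ℓ₀ 0)‖ = 1 ∧ ‖Complex.exp (D.ℓ₁ 0)‖ = 1 ∧ (G 0).re = 0 := by
  intro D G β hG hjet hβ hirr hG0 hβim
  /- (1) the defect `ℓ₁ (T σ) - β ℓ₀ (T σ) - G (T σ)` on the punctured `σ`-disc -/
  have hdef : ∀ σ : ℂ, 0 < ‖σ‖ → ‖σ‖ < D.ρ →
      D.ℓ₁ (D.T σ) - β * D.ℓ₀ (D.T σ) - G (D.T σ) =
        2 * ↑π * I * (β * σ⁻¹ ^ D.e - (D.A.eval σ⁻¹ + D.g σ)) := by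
    intro σ h0 hρ
    obtain ⟨hT0, hTr, h1, h2, h3, h4⟩ := D.link σ h0 hρ
    have hj := hjet (D.T σ) hT0 hTr
    linear_combination h4 - β * h3 - h2 + hj + β * h1
  /- (2) on the positive real ray the real part of the defect vanishes eventually -/
  have hray : ∀ᶠ u : ℝ in 𝓝[>] 0,
      (D.ℓ₁ (D.T (u : ℂ)) - β * D.ℓ₀ (D.T (u : ℂ)) - G (D.T (u : ℂ))).re = 0 := by
    filter_upwards [Ioo_mem_nhdsGT D.ρ_pos, D.real.2] with u hu hgu
    have hnorm : ‖(u : ℂ)‖ = u := Complex.norm_of_nonneg hu.1.le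
    rw [hdef u (by rw [hnorm]; exact hu.1) (by rw [hnorm]; exact hu.2)]
    have hA : (D.A.eval ((u : ℂ)⁻¹)).im = 0 := by
      rw [← Complex.ofReal_inv, Polynomial.eval_eq_sum_range, Complex.im_sum]
      refine Finset.sum_eq_zero fun k _ => ?_
      rw [← Complex.ofReal_pow, Complex.mul_im, Complex.ofReal_re, Complex.ofReal_im, D.real.1 k]
      ring
    have hβu : (β * (u : ℂ)⁻¹ ^ D.e).im = 0 := by
      rw [← Complex.ofReal_inv, ← Complex.ofReal_pow, Complex.mul_im, Complex.ofReal_re,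
        Complex.ofReal_im, hβim]
      ring
    have hZ : (β * (u : ℂ)⁻¹ ^ D.e - (D.A.eval (u : ℂ)⁻¹ + D.g u)).im = 0 := by
      rw [Complex.sub_im, Complex.add_im, hA, hgu, hβu]
      ring
    rw [Complex.mul_re, hZ]
    simp
  /- (3) continuity at `σ = 0` along the ray (`T 0 = 0`) -/
  have hT0' : D.T ((0 : ℝ) : ℂ) = 0 := by simp [D.T_zero]
  have hTc : ContinuousAt (fun u : ℝ => D.T (u : ℂ)) 0 :=
    D.T_analytic.continuousAt.comp_of_eq Complex.continuous_ofReal.continuousAt (by simp)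
  have h₁ : ContinuousAt (fun u : ℝ => D.ℓ₁ (D.T (u : ℂ))) 0 :=
    D.ℓ₁_analytic.continuousAt.comp_of_eq hTc hT0'
  have h₀ : ContinuousAt (fun u : ℝ => D.ℓ₀ (D.T (u : ℂ))) 0 :=
    D.ℓ₀_analytic.continuousAt.comp_of_eq hTc hT0'
  have hG' : ContinuousAt (fun u : ℝ => G (D.T (u : ℂ))) 0 :=
    hG.continuousAt.comp_of_eq hTc hT0'
  have hcont : ContinuousAt
      (fun u : ℝ => (D.ℓ₁ (D.T (u : ℂ)) - β * D.ℓ₀ (D.T (u : ℂ)) - G (D.T (u : ℂ))).re) 0 :=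
    Complex.continuous_re.continuousAt.comp ((h₁.sub (continuousAt_const.mul h₀)).sub hG')
  have hlim := hcont.tendsto.mono_left (nhdsWithin_le_nhds (s := Set.Ioi (0 : ℝ)))
  have hF0 := tendsto_nhds_unique_of_eventuallyEq hlim tendsto_const_nhds hray
  rw [hT0'] at hF0
  /- (4) the real relation `u₁ = β u₀ + r` -/
  have hβre : ((β.re : ℝ) : ℂ) = β := Complex.ext (by simp) (by simp [hβim])
  have hrelR : (D.ℓ₁ 0).re = β.re * (D.ℓ₀ 0).re + (G 0).re := by
    have : (D.ℓ₁ 0).re - (β.re * (D.ℓ₀ 0).re - β.im * (D.ℓ₀ 0).im) - (G 0).re = 0 := by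
      simpa [Complex.sub_re, Complex.mul_re] using hF0
    rw [hβim] at this
    linarith
  have hrel : (((D.ℓ₁ 0).re : ℝ) : ℂ) = β * (((D.ℓ₀ 0).re : ℝ) : ℂ) + (((G 0).re : ℝ) : ℂ) := by
    rw [← hβre]
    exact_mod_cast hrelR
  /- (5) Baker -/
  obtain ⟨hu₀, hu₁, hr⟩ := baker_affine_trivial (isAlgebraic_exp_ofReal_re D.exp_ℓ₀_algebraic)
    (isAlgebraic_exp_ofReal_re D.exp_ℓ₁_algebraic) hβ hirr (isAlgebraic_ofReal_re hG0) hrel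
  rw [Complex.ofReal_eq_zero] at hu₀ hu₁ hr
  refine ⟨?_, ?_, hr⟩
  · rw [Complex.norm_exp, hu₀, Real.exp_zero]
  · rw [Complex.norm_exp, hu₁, Real.exp_zero]

end Summit.Schanuel.Schanuel.Cruxes.SparsityTwo.CuspGermSchneiderSparsity

end
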